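/-
Copyright (c) 2026 the pub-hodgecm-mathlib formalisation cell (harness21).  Prover seat hodgecm-mathlib-F0P2-p06 (g10), 2026-09-01.  Road «S3-tree» (architect A-p16 (g30) A-88 (8)),
brick T3′ «depth-zero κ-transfer», population (P-2) TYPE (2), row (R0²): organ FILE γ₄ «THE SHIFTED ORDER AT A CM PLACE» — the hypotheses `hY hY′ hX` of ★ ROW-0 = #FIX(Y) for the
Cayley∕Möbius shift `Y = (δ′)_w = φ_{c_w}(δ_w)` of a match `δ` of a deep type-(2) `γ_H`: `Y, Y⁻¹ ∈ 𝒪_w[X_δ]`, `X_δ ∈ 𝒪_w[Y]`, `X_δ = 1 + c_w⁻¹(δ_w − 1)`.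
-/
import Literature.NumberTheory.Rogawski1990.TypeTwoCayleyShiftBindersCM     -- ★ FILE γ₃ (this seat): units of the denominators; brings ★ γ₂, γ₁, α, β
import HarnessLib

/-!
# The shifted order at a CM place: `φ(δ)_w, φ(δ)_w⁻¹ ∈ 𝒪_w[1 + c_w⁻¹(δ_w − 1)]` and `1 + c_w⁻¹(δ_w − 1) ∈ 𝒪_w[φ(δ)_w]`

Topic `NumberTheory/Rogawski1990`; namespace `Literature.NumberTheory.Rogawski1990`.  THEOREMS ONLY (no definition, no instance, no notation, no named fact, no `sorry`); kernel lane
`--supports stmt-HodgeConjecture-24833`.  Cell `pub/hodgecm-mathlib`, crux H413; road «S3-tree», brick T3′ «depth-zero κ-transfer», row (R0²) of the ★ type-(2) socket p846003 (census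
`F0/P2/F0P2-p06/g10/CENSUS-T3prime-P2-assembly.F0P2p06g10.md` §3 (a); hand-off `F0/P2/F0P2-p06/g10/HANDOFF-P2-RowZero.F0P2p06g10.md` (γ₄-b)).  HONEST LABEL: HC_CM is proved only modulo the
cell's 2 remaining named inputs (hLiu418, h413) until rung 0 closes; this file is an ASSEMBLY over ★ material and asserts nothing printed.

THE MATHEMATICS.  `ι(γ_H)_w = 1 + c_w·W` with `W = c_w⁻¹(ι(γ_H)_w − 1)` entrywise integral (deepness in `V`) and block diagonal (`X₂ = c_w⁻¹(g_w − 1)`, `y = c_w⁻¹(u_w − 1)`), so `N± = 2 + (c_w ± 1)W`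
have unit determinants (★ γ₃∕γ₁: `det((c_w∓1)ι + (c_w±1)) = c_w³·det N∓`).  ★ FILE α §4 then gives `Y₀ := N₊N₋⁻¹ = φ(ι(γ_H)_w) ∈ 𝒪_w[W]`, `Y₀⁻¹ ∈ 𝒪_w[W]`, `W ∈ 𝒪_w[Y₀]`.  A match `δ` is
`x·ι(γ_H)·x⁻¹` in `GL₃(E_v)`, so at `w`: `δ_w = x_w ι_w x_w⁻¹`, `φ(δ_w) = x_w Y₀ x_w⁻¹` (★ α `moebius_conj`), `1 + c_w⁻¹(δ_w − 1) = x_w(1 + W)x_w⁻¹`, and conjugation transports the three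
memberships (★ γ₂ `conj_mem_adjoin_of_mem_adjoin`, `𝒪[W] ⊆ 𝒪[1 + W]`).  The integers are the `ValuativeRel` integers `𝒪[L_w]` of ★ ROW-0 (bridge ★ `integer_valuation_eq_valuedInteger`).

## References
* [Kottwitz1986] R. E. Kottwitz, *Base change for unit elements of Hecke algebras*, Compositio Math. 60 (1986), §3.
* [Rogawski1990] J. D. Rogawski, *Automorphic Representations of Unitary Groups in Three Variables* (1990), §4.9 Prop. 4.9.1 (b) p. 55.
* [Serre1980Trees] J.-P. Serre, *Trees* (1980), Ch. II §1.1–1.2.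
-/

set_option autoImplicit false

noncomputable section

open NumberField IsDedekindDomain Matrix Polynomial
open scoped MatrixGroups WithZero ValuativeRel

namespace Literature.NumberTheory.Rogawski1990

open Literature.NumberTheory.Automorphic Literature.NumberTheory.Automorphic.UnitaryGroup Literature.NumberTheory.Automorphic.MoebiusShift
open Literature.NumberTheory.GaloisRepresentations Literature.NumberTheory.NumberFields

variable (L : Type) [Field L] [NumberField L] [IsCMField L] (v : HeightOneSpectrum (𝓞 ↥(maximalRealSubfield L)))
  (w : PlacesOver L v) (hw : IsCMField.complexConj L • w.1 = w.1)

omit [IsCMField L] in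
/-- The `ValuativeRel` integers of `L_w` are cut out by `Valued.v ≤ 1` (★ `integer_valuation_eq_valuedInteger`). [cite: Serre1980Trees, Ch. II §1.1–1.2] -/
theorem mem_integer_iff_valued_le_one (x : w.1.adicCompletion L) : x ∈ 𝒪[w.1.adicCompletion L] ↔ Valued.v x ≤ 1 := by
  rw [integer_valuation_eq_valuedInteger]
  exact Valuation.mem_integer_iff _ _

omit [IsCMField L] [NumberField L] in
/-- `(x·ι x⁻¹)` side: `a·(PMP⁻¹) + b·1 = P(a·M + b·1)P⁻¹` for `P ∈ GL`. [cite: Kottwitz1986, §3] -/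
theorem smul_units_conj_add_smul_one {R : Type*} [CommRing R] {m : Type*} [Fintype m] [DecidableEq m] (P : GL m R) (M : Matrix m m R) (a b : R) :
    a • ((P : Matrix m m R) * M * ((P⁻¹ : GL m R) : Matrix m m R)) + b • (1 : Matrix m m R) =
      (P : Matrix m m R) * (a • M + b • 1) * ((P⁻¹ : GL m R) : Matrix m m R) := by
  rw [Matrix.mul_add, Matrix.add_mul, Matrix.mul_smul, Matrix.smul_mul, Matrix.mul_smul, Matrix.smul_mul, Matrix.mul_one, ← Units.val_mul, mul_inv_cancel, Units.val_one]

omit [IsCMField L] [NumberField L] in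
/-- `(PMP⁻¹)⁻¹ = PM⁻¹P⁻¹` for `P ∈ GL` and `det M` a unit. [cite: Kottwitz1986, §3] -/
theorem units_conj_nonsing_inv {K : Type*} [Field K] {m : Type*} [Fintype m] [DecidableEq m] (P : GL m K) (M : Matrix m m K) (hM : IsUnit M.det) :
    ((P : Matrix m m K) * M * ((P⁻¹ : GL m K) : Matrix m m K))⁻¹ = (P : Matrix m m K) * M⁻¹ * ((P⁻¹ : GL m K) : Matrix m m K) := by
  refine Matrix.inv_eq_right_inv ?_
  have hPP : ((P⁻¹ : GL m K) : Matrix m m K) * (P : Matrix m m K) = 1 := by rw [← Units.val_mul, inv_mul_cancel, Units.val_one]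
  calc (P : Matrix m m K) * M * ((P⁻¹ : GL m K) : Matrix m m K) * ((P : Matrix m m K) * M⁻¹ * ((P⁻¹ : GL m K) : Matrix m m K))
      = (P : Matrix m m K) * (M * (((P⁻¹ : GL m K) : Matrix m m K) * (P : Matrix m m K)) * M⁻¹) * ((P⁻¹ : GL m K) : Matrix m m K) := by
        simp only [Matrix.mul_assoc]
    _ = 1 := by rw [hPP, Matrix.mul_one, Matrix.mul_nonsing_inv _ hM, Matrix.mul_one, ← Units.val_mul, mul_inv_cancel, Units.val_one]

include hw in
set_option maxHeartbeats 1600000 in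
-- the carriers' types are large
/-- **THE SHIFTED ORDER MEMBERSHIPS** (`hY hY′ hX` of ★ ROW-0 = #FIX(Y)): for a deep type-(2) `γ_H` (`g_w ≡ 1`, `u_w ≡ 1 (mod c_w)` entrywise, `|disc χ_g|_w = exp(−(2N+1))`, `N ≥ 1`,
`|c_w| = exp(−1)`, `σ(c) = c`, `|2|_w = 1`), a match `δ` of `γ_H` and `δ′` with matrix `φ_c(δ)`: with `Y := (δ′)_w`, `X_δ := 1 + c_w⁻¹((δ)_w − 1)`,
`Y ∈ 𝒪_w[X_δ]`, `Y⁻¹ ∈ 𝒪_w[X_δ]`, `X_δ ∈ 𝒪_w[Y]`. [cite: Kottwitz1986, §3] [cite: Rogawski1990, §4.9 Prop. 4.9.1 (b) p. 55] [cite: Serre1980Trees, Ch. II §1.1–1.2] -/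
theorem shifted_order_memberships (H' : Matrix (Fin 3) (Fin 3) L)
    (γH : (cmDatum L 2 (Matrix.of fun i j : Fin 2 => if i.val + j.val + 1 = 2 then (1 : L) else 0)).Local v ×
      (cmDatum L 1 (Matrix.of fun i j : Fin 1 => if i.val + j.val + 1 = 1 then (1 : L) else 0)).Local v)
    (δ δ' : (cmDatum L 3 H').Local v)
    {c : LocalRing L v} (hσc : conjLocal L (IsCMField.complexConj L) v c = c) (hc : Valued.v (c w) = WithZero.exp (-1 : ℤ))
    (h2 : Valued.v (2 : w.1.adicCompletion L) = 1)
    (hg1 : ∀ i j, Valued.v ((((γH.1.val : GL (Fin 2) (LocalRing L v)).val.map (Pi.evalRingHom (fun w' : PlacesOver L v => w'.1.adicCompletion L) w)) - 1) i j) ≤ Valued.v (c w))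
    (hu1 : Valued.v (finGammaTwo L v γH w - 1) ≤ Valued.v (c w))
    {N : ℕ} (hN1 : 1 ≤ N)
    (hN : Valued.v (((γH.1.val : GL (Fin 2) (LocalRing L v)).val.map
        (Pi.evalRingHom (fun w' : PlacesOver L v => w'.1.adicCompletion L) w)).trace ^ 2 -
      4 * ((γH.1.val : GL (Fin 2) (LocalRing L v)).val.map
        (Pi.evalRingHom (fun w' : PlacesOver L v => w'.1.adicCompletion L) w)).det) = WithZero.exp (-((2 * N + 1 : ℕ) : ℤ)))
    (h : IsLocalNormPair L H' v γH δ)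
    (hδ : ((δ'.val : GL (Fin 3) (LocalRing L v)).val : Matrix (Fin 3) (Fin 3) (LocalRing L v)) =
      ((c + 1) • ((δ.val : GL (Fin 3) (LocalRing L v)).val : Matrix (Fin 3) (Fin 3) (LocalRing L v)) + (c - 1) • 1) *
        ((c - 1) • ((δ.val : GL (Fin 3) (LocalRing L v)).val : Matrix (Fin 3) (Fin 3) (LocalRing L v)) + (c + 1) • 1)⁻¹) :
    ((δ'.val : GL (Fin 3) (LocalRing L v)).val.map (Pi.evalRingHom (fun w' : PlacesOver L v => w'.1.adicCompletion L) w)) ∈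
        Algebra.adjoin 𝒪[w.1.adicCompletion L] ({1 + (c w)⁻¹ • (((δ.val : GL (Fin 3) (LocalRing L v)).val.map
          (Pi.evalRingHom (fun w' : PlacesOver L v => w'.1.adicCompletion L) w)) - 1)} : Set (Matrix (Fin 3) (Fin 3) (w.1.adicCompletion L))) ∧
      ((δ'.val : GL (Fin 3) (LocalRing L v)).val.map (Pi.evalRingHom (fun w' : PlacesOver L v => w'.1.adicCompletion L) w))⁻¹ ∈
        Algebra.adjoin 𝒪[w.1.adicCompletion L] ({1 + (c w)⁻¹ • (((δ.val : GL (Fin 3) (LocalRing L v)).val.map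
          (Pi.evalRingHom (fun w' : PlacesOver L v => w'.1.adicCompletion L) w)) - 1)} : Set (Matrix (Fin 3) (Fin 3) (w.1.adicCompletion L))) ∧
      (1 + (c w)⁻¹ • (((δ.val : GL (Fin 3) (LocalRing L v)).val.map (Pi.evalRingHom (fun w' : PlacesOver L v => w'.1.adicCompletion L) w)) - 1)) ∈
        Algebra.adjoin 𝒪[w.1.adicCompletion L] ({((δ'.val : GL (Fin 3) (LocalRing L v)).val.map
          (Pi.evalRingHom (fun w' : PlacesOver L v => w'.1.adicCompletion L) w))} : Set (Matrix (Fin 3) (Fin 3) (w.1.adicCompletion L))) := by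
  have hv : Subsingleton (PlacesOver L v) := PlacesOver.subsingleton_of_smul_eq (IsCMField.complexConj L) (IsCMField.complexConj_ne_one L) w hw
  obtain ⟨hw2m, hw2p, hw1m, hw1p, -, -, -, -, -, -, hU3⟩ := isUnit_shift_denominators_of_typeTwo L v w hw γH hσc hc h2 hg1 hu1 hN1 hN
  set evw : LocalRing L v →+* w.1.adicCompletion L := Pi.evalRingHom (fun w' : PlacesOver L v => w'.1.adicCompletion L) w with hevw
  set O : Subring (w.1.adicCompletion L) := 𝒪[w.1.adicCompletion L] with hOdef
  have hO : ∀ {z : w.1.adicCompletion L}, z ∈ O ↔ Valued.v z ≤ 1 := fun {z} => mem_integer_iff_valued_le_one L v w z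
  set gw : Matrix (Fin 2) (Fin 2) (w.1.adicCompletion L) := ((γH.1.val : GL (Fin 2) (LocalRing L v)).val.map evw) with hgw
  set Uw : Matrix (Fin 1) (Fin 1) (w.1.adicCompletion L) := ((γH.2.val : GL (Fin 1) (LocalRing L v)).val.map evw) with hUw
  set uw : w.1.adicCompletion L := finGammaTwo L v γH w with huw
  set cw : w.1.adicCompletion L := c w with hcw
  set ιw : Matrix (Fin 3) (Fin 3) (w.1.adicCompletion L) := (((endoEmbLocal L v γH).val : GL (Fin 3) (LocalRing L v)).val.map evw) with hιw
  set δw : Matrix (Fin 3) (Fin 3) (w.1.adicCompletion L) := ((δ.val : GL (Fin 3) (LocalRing L v)).val.map evw) with hδw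
  obtain ⟨hc0, hc1, hcm, hcp, -, -⟩ := shift_parameter_facts hc
  have hUw00 : Uw 0 0 = uw := rfl
  -- `ι_w = reindex endoPerm (g_w ⊕ U_w)` and `W = c_w⁻¹(ι_w − 1) = reindex endoPerm (X₂ ⊕ Y₁)`
  have hι : ιw = Matrix.reindex endoPerm endoPerm (Matrix.fromBlocks gw 0 0 Uw) := by
    rw [hιw, coe_endoEmbLocal, coe_endoGL, Matrix.reindex_apply, ← Matrix.submatrix_map, Matrix.fromBlocks_map]
    simp [Matrix.reindex_apply, gw, Uw]
  set X₂ : Matrix (Fin 2) (Fin 2) (w.1.adicCompletion L) := cw⁻¹ • (gw - 1) with hX₂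
  set Y₁ : Matrix (Fin 1) (Fin 1) (w.1.adicCompletion L) := cw⁻¹ • (Uw - 1) with hY₁
  set W : Matrix (Fin 3) (Fin 3) (w.1.adicCompletion L) := cw⁻¹ • (ιw - 1) with hW
  have hιW : ιw = 1 + cw • W := eq_one_add_smul_inv_smul_sub_one hc0 ιw
  have hWb : W = Matrix.reindex endoPerm endoPerm (Matrix.fromBlocks X₂ 0 0 Y₁) := by
    have e1 : ιw - 1 = Matrix.reindex endoPerm endoPerm (Matrix.fromBlocks (gw - 1) 0 0 (Uw - 1)) := by
      have h := smul_reindex_add_smul_one (R := w.1.adicCompletion L) endoPerm (Matrix.fromBlocks gw 0 0 Uw) 1 (-1)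
      rw [smul_fromBlocks_add_smul_one, one_smul, one_smul, one_smul, neg_one_smul, neg_one_smul, neg_one_smul, ← sub_eq_add_neg, ← sub_eq_add_neg, ← sub_eq_add_neg, ← hι] at h
      exact h
    rw [hW, e1, hX₂, hY₁, Matrix.reindex_apply, Matrix.reindex_apply]
    have e2 : Matrix.fromBlocks (cw⁻¹ • (gw - 1)) 0 0 (cw⁻¹ • (Uw - 1)) = cw⁻¹ • Matrix.fromBlocks (gw - 1) 0 0 (Uw - 1) := by
      rw [Matrix.fromBlocks_smul, smul_zero, smul_zero]
    rw [e2]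
    rfl
  -- entrywise integrality of `W`
  have hX₂i : ∀ i j, Valued.v (X₂ i j) ≤ 1 := forall_valued_inv_smul_sub_one_le_one hc0 hg1
  have hY₁i : ∀ i j, Valued.v (Y₁ i j) ≤ 1 := fun i j => by
    obtain rfl : i = 0 := Subsingleton.elim _ _
    obtain rfl : j = 0 := Subsingleton.elim _ _
    rw [hY₁, Matrix.smul_apply, Matrix.sub_apply, Matrix.one_apply_eq, hUw00, smul_eq_mul]
    exact valued_inv_mul_sub_one_le_one hc0 hu1
  have hWi : ∀ i j, Valued.v (W i j) ≤ 1 := by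
    intro i j
    rw [hWb, Matrix.reindex_apply, Matrix.submatrix_apply]
    rcases endoPerm.symm i with a | a <;> rcases endoPerm.symm j with b | b
    · rw [Matrix.fromBlocks_apply₁₁]; exact hX₂i a b
    · rw [Matrix.fromBlocks_apply₁₂, Matrix.zero_apply, map_zero]; exact zero_le
    · rw [Matrix.fromBlocks_apply₂₁, Matrix.zero_apply, map_zero]; exact zero_le
    · rw [Matrix.fromBlocks_apply₂₂]; exact hY₁i a b
  have hWO : ∀ i j, W i j ∈ O := fun i j => hO.2 (hWi i j)
  have hcO : cw ∈ O := hO.2 hc1.le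
  -- the determinants of `N± = 2 + (c_w ± 1)W` are units: `det((c∓1)g + (c±1)) = c²·det N∓(X₂)`, `(c∓1)u + (c±1) = c·(2 + (c∓1)y)`
  have hgX : gw = 1 + cw • X₂ := eq_one_add_smul_inv_smul_sub_one hc0 gw
  have huy : uw = 1 + cw * (cw⁻¹ * (uw - 1)) := by rw [← mul_assoc, mul_inv_cancel₀ hc0, one_mul, add_sub_cancel]
  have hdet2w : ∀ a b : LocalRing L v, ((a • ((γH.1.val : GL (Fin 2) (LocalRing L v)).val : Matrix (Fin 2) (Fin 2) (LocalRing L v)) + b • (1 : Matrix (Fin 2) (Fin 2) (LocalRing L v))).det) w =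
      (a w • gw + b w • (1 : Matrix (Fin 2) (Fin 2) (w.1.adicCompletion L))).det := fun a b => by
    have e1 : ((a • ((γH.1.val : GL (Fin 2) (LocalRing L v)).val : Matrix (Fin 2) (Fin 2) (LocalRing L v)) + b • (1 : Matrix (Fin 2) (Fin 2) (LocalRing L v))).det) w =
        evw ((a • ((γH.1.val : GL (Fin 2) (LocalRing L v)).val : Matrix (Fin 2) (Fin 2) (LocalRing L v)) + b • (1 : Matrix (Fin 2) (Fin 2) (LocalRing L v))).det) := rfl
    rw [e1, RingHom.map_det, RingHom.mapMatrix_apply, map_smul_add_smul_one]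
    rfl
  have hNdet : ∀ t : w.1.adicCompletion L, ((2 : w.1.adicCompletion L) • (1 : Matrix (Fin 3) (Fin 3) (w.1.adicCompletion L)) + t • W).det =
      ((2 : w.1.adicCompletion L) • (1 : Matrix (Fin 2) (Fin 2) (w.1.adicCompletion L)) + t • X₂).det * (2 + t * (cw⁻¹ * (uw - 1))) := fun t => by
    rw [hWb, add_comm, smul_reindex_add_smul_one, smul_fromBlocks_add_smul_one, Matrix.det_reindex_self, Matrix.det_fromBlocks_zero₁₂, add_comm (t • X₂), Matrix.det_fin_one]
    congr 1
    rw [Matrix.add_apply, Matrix.smul_apply, Matrix.smul_apply, Matrix.one_apply_eq, hY₁, Matrix.smul_apply, Matrix.sub_apply, Matrix.one_apply_eq, hUw00]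
    simp only [smul_eq_mul, mul_one]
    ring
  have hvm2 : Valued.v (((2 : w.1.adicCompletion L) • (1 : Matrix (Fin 2) (Fin 2) (w.1.adicCompletion L)) + (cw - 1) • X₂).det) = 1 := by
    have e := hdet2w (c - 1) (c + 1)
    rw [show (c - 1) w = cw - 1 from rfl, show (c + 1) w = cw + 1 from rfl, hgX, smul_one_add_smul_add_smul_one X₂ cw (cw - 1) (cw + 1) (by ring), Matrix.det_smul,
      Fintype.card_fin] at e
    have h := hw2m
    rw [e, map_mul, map_pow, hc, ← WithZero.exp_nsmul] at h
    have hne : WithZero.exp ((2 : ℕ) • (-1 : ℤ)) ≠ 0 := WithZero.exp_ne_zero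
    have h' := (eq_inv_mul_iff_mul_eq₀ hne).2 h
    rw [h', ← WithZero.exp_neg, ← WithZero.exp_add, ← WithZero.exp_zero, WithZero.exp_inj]
    simp
  have hvp2 : Valued.v (((2 : w.1.adicCompletion L) • (1 : Matrix (Fin 2) (Fin 2) (w.1.adicCompletion L)) + (cw + 1) • X₂).det) = 1 := by
    have e := hdet2w (c + 1) (c - 1)
    rw [show (c - 1) w = cw - 1 from rfl, show (c + 1) w = cw + 1 from rfl, hgX, smul_one_add_smul_add_smul_one X₂ cw (cw + 1) (cw - 1) (by ring), Matrix.det_smul,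
      Fintype.card_fin] at e
    have h := hw2p
    rw [e, map_mul, map_pow, hc, ← WithZero.exp_nsmul] at h
    have hne : WithZero.exp ((2 : ℕ) • (-1 : ℤ)) ≠ 0 := WithZero.exp_ne_zero
    have h' := (eq_inv_mul_iff_mul_eq₀ hne).2 h
    rw [h', ← WithZero.exp_neg, ← WithZero.exp_add, ← WithZero.exp_zero, WithZero.exp_inj]
    simp
  have hvm1 : Valued.v (2 + (cw - 1) * (cw⁻¹ * (uw - 1))) = 1 := by
    have e : ((c - 1) * finGammaTwo L v γH + (c + 1)) w = cw * (2 + (cw - 1) * (cw⁻¹ * (uw - 1))) := by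
      have e0 : ((c - 1) * finGammaTwo L v γH + (c + 1)) w = (cw - 1) * uw + (cw + 1) := rfl
      rw [e0]; nth_rewrite 1 [huy]; ring
    have h := hw1m
    rw [e, map_mul, hc] at h
    have h' := (eq_inv_mul_iff_mul_eq₀ (WithZero.exp_ne_zero (a := (-1 : ℤ)))).2 h
    rw [h', ← WithZero.exp_neg, ← WithZero.exp_add, ← WithZero.exp_zero, WithZero.exp_inj]
    simp
  have hvp1 : Valued.v (2 + (cw + 1) * (cw⁻¹ * (uw - 1))) = 1 := by
    have e : ((c + 1) * finGammaTwo L v γH + (c - 1)) w = cw * (2 + (cw + 1) * (cw⁻¹ * (uw - 1))) := by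
      have e0 : ((c + 1) * finGammaTwo L v γH + (c - 1)) w = (cw + 1) * uw + (cw - 1) := rfl
      rw [e0]; nth_rewrite 1 [huy]; ring
    have h := hw1p
    rw [e, map_mul, hc] at h
    have h' := (eq_inv_mul_iff_mul_eq₀ (WithZero.exp_ne_zero (a := (-1 : ℤ)))).2 h
    rw [h', ← WithZero.exp_neg, ← WithZero.exp_add, ← WithZero.exp_zero, WithZero.exp_inj]
    simp
  have hunit : ∀ {z : w.1.adicCompletion L}, Valued.v z = 1 → ∃ d ∈ O, d * z = 1 := fun {z} hz => by
    have hz0 : z ≠ 0 := fun h0 => by rw [h0, map_zero] at hz; exact zero_ne_one hz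
    exact ⟨z⁻¹, hO.2 (by rw [map_inv₀, hz, inv_one]), inv_mul_cancel₀ hz0⟩
  have hm : ∃ d ∈ O, d * ((2 : w.1.adicCompletion L) • (1 : Matrix (Fin 3) (Fin 3) (w.1.adicCompletion L)) + (cw - 1) • W).det = 1 :=
    hunit (by rw [hNdet, map_mul, hvm2, hvm1, one_mul])
  have hp : ∃ d ∈ O, d * ((2 : w.1.adicCompletion L) • (1 : Matrix (Fin 3) (Fin 3) (w.1.adicCompletion L)) + (cw + 1) • W).det = 1 :=
    hunit (by rw [hNdet, map_mul, hvp2, hvp1, one_mul])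
  have h2O : ∃ e ∈ O, e * 2 = 1 := hunit h2
  have hc1O : ∃ e ∈ O, e * (cw - 1) = 1 := hunit hcm
  -- ★ FILE α §4: the order identity for `W`
  set Y₀ : Matrix (Fin 3) (Fin 3) (w.1.adicCompletion L) := ((2 : w.1.adicCompletion L) • (1 : Matrix (Fin 3) (Fin 3) (w.1.adicCompletion L)) + (cw + 1) • W) *
    ((2 : w.1.adicCompletion L) • (1 : Matrix (Fin 3) (Fin 3) (w.1.adicCompletion L)) + (cw - 1) • W)⁻¹ with hY₀
  have hY₀mem : Y₀ ∈ Algebra.adjoin O ({W} : Set (Matrix (Fin 3) (Fin 3) (w.1.adicCompletion L))) := moebius_mem_adjoin O hWO hcO hm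
  have hY₀inv : Y₀⁻¹ ∈ Algebra.adjoin O ({W} : Set (Matrix (Fin 3) (Fin 3) (w.1.adicCompletion L))) := moebius_inv_mem_adjoin O hWO hcO hm hp
  have hWmem : W ∈ Algebra.adjoin O ({Y₀} : Set (Matrix (Fin 3) (Fin 3) (w.1.adicCompletion L))) := mem_adjoin_moebius O hWO hcO h2O hc1O hm
  -- the match: `δ_w = x_w ι_w x_w⁻¹`
  obtain ⟨x, hx⟩ := isConj_iff.1 h
  have hxdet : IsUnit (((x : GL (Fin 3) (LocalRing L v)) : Matrix (Fin 3) (Fin 3) (LocalRing L v)).map evw).det := by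
    rw [← RingHom.mapMatrix_apply, ← RingHom.map_det]; exact (Matrix.isUnits_det_units x).map _
  set P : GL (Fin 3) (w.1.adicCompletion L) := Matrix.nonsingInvUnit _ hxdet with hP
  have hPv : (P : Matrix (Fin 3) (Fin 3) (w.1.adicCompletion L)) = ((x : GL (Fin 3) (LocalRing L v)) : Matrix (Fin 3) (Fin 3) (LocalRing L v)).map evw := rfl
  have hPi : ((P⁻¹ : GL (Fin 3) (w.1.adicCompletion L)) : Matrix (Fin 3) (Fin 3) (w.1.adicCompletion L)) = (((x : GL (Fin 3) (LocalRing L v)) : Matrix (Fin 3) (Fin 3) (LocalRing L v)).map evw)⁻¹ := by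
    rw [Matrix.coe_units_inv, hPv]
  have hδconj : δw = (P : Matrix (Fin 3) (Fin 3) (w.1.adicCompletion L)) * ιw * ((P⁻¹ : GL (Fin 3) (w.1.adicCompletion L)) : Matrix (Fin 3) (Fin 3) (w.1.adicCompletion L)) := by
    have hm : ((δ.val : GL (Fin 3) (LocalRing L v)).val : Matrix (Fin 3) (Fin 3) (LocalRing L v)) =
        (x : GL (Fin 3) (LocalRing L v)).val * (((endoEmbLocal L v γH).val : GL (Fin 3) (LocalRing L v)).val) * (x⁻¹ : GL (Fin 3) (LocalRing L v)).val := by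
      rw [← hx, Units.val_mul, Units.val_mul]; rfl
    rw [hδw, hm, Matrix.map_mul, Matrix.map_mul, Matrix.coe_units_inv, map_nonsing_inv_of_isUnit evw _ (Matrix.isUnits_det_units x), hPi, hPv]
  -- `φ(δ)_w = P·Y₀·P⁻¹` and `X_δ = P(1 + W)P⁻¹`
  have hNu : IsUnit ((2 : w.1.adicCompletion L) • (1 : Matrix (Fin 3) (Fin 3) (w.1.adicCompletion L)) + (cw - 1) • W).det := by
    obtain ⟨d, -, hd⟩ := hm; exact IsUnit.of_mul_eq_one_right d hd
  have hDι : IsUnit ((cw - 1) • ιw + (cw + 1) • (1 : Matrix (Fin 3) (Fin 3) (w.1.adicCompletion L))).det := by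
    rw [hιW, smul_one_add_smul_add_smul_one W cw (cw - 1) (cw + 1) (by ring), Matrix.det_smul]
    exact (IsUnit.pow _ (isUnit_iff_ne_zero.2 hc0)).mul hNu
  have hφι : ((cw + 1) • ιw + (cw - 1) • (1 : Matrix (Fin 3) (Fin 3) (w.1.adicCompletion L))) * ((cw - 1) • ιw + (cw + 1) • (1 : Matrix (Fin 3) (Fin 3) (w.1.adicCompletion L)))⁻¹ = Y₀ := by
    rw [hιW]; exact moebius_one_add_smul_eq W hc0 hNu
  have hYw : ((δ'.val : GL (Fin 3) (LocalRing L v)).val.map evw) = (P : Matrix (Fin 3) (Fin 3) (w.1.adicCompletion L)) * Y₀ * ((P⁻¹ : GL (Fin 3) (w.1.adicCompletion L)) : Matrix (Fin 3) (Fin 3) (w.1.adicCompletion L)) := by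
    have hDδ : IsUnit ((c - 1) • ((δ.val : GL (Fin 3) (LocalRing L v)).val : Matrix (Fin 3) (Fin 3) (LocalRing L v)) + (c + 1) • (1 : Matrix (Fin 3) (Fin 3) (LocalRing L v))).det := by
      have hm : ((δ.val : GL (Fin 3) (LocalRing L v)).val : Matrix (Fin 3) (Fin 3) (LocalRing L v)) =
          (x : GL (Fin 3) (LocalRing L v)).val * (((endoEmbLocal L v γH).val : GL (Fin 3) (LocalRing L v)).val) * (x⁻¹ : GL (Fin 3) (LocalRing L v)).val := by
        rw [← hx, Units.val_mul, Units.val_mul]; rfl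
      rw [hm, smul_units_conj_add_smul_one, Matrix.det_units_conj]
      exact hU3
    rw [hδ, map_moebius evw _ _ _ hDδ, map_add, map_sub, map_one]
    change ((cw + 1) • δw + (cw - 1) • (1 : Matrix (Fin 3) (Fin 3) (w.1.adicCompletion L))) * ((cw - 1) • δw + (cw + 1) • 1)⁻¹ = _
    rw [hδconj, Matrix.coe_units_inv, moebius_conj _ _ (Matrix.isUnits_det_units P) _ _ hDι, hφι]
  have hXw : 1 + cw⁻¹ • (δw - 1) = (P : Matrix (Fin 3) (Fin 3) (w.1.adicCompletion L)) * (1 + W) * ((P⁻¹ : GL (Fin 3) (w.1.adicCompletion L)) : Matrix (Fin 3) (Fin 3) (w.1.adicCompletion L)) := by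
    have h1 := smul_units_conj_add_smul_one P ιw cw⁻¹ (1 - cw⁻¹)
    have e2 : cw⁻¹ • ιw + (1 - cw⁻¹) • (1 : Matrix (Fin 3) (Fin 3) (w.1.adicCompletion L)) = 1 + W := by rw [hW, smul_sub, sub_smul, one_smul]; abel
    rw [e2] at h1
    rw [← h1, hδconj, smul_sub, sub_smul, one_smul]
    abel
  -- transport of the three memberships along `P`
  refine ⟨?_, ?_, ?_⟩
  · rw [hYw]
    change _ ∈ Algebra.adjoin O ({1 + cw⁻¹ • (δw - 1)} : Set (Matrix (Fin 3) (Fin 3) (w.1.adicCompletion L)))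
    rw [hXw]
    exact conj_mem_adjoin_of_mem_adjoin O P (mem_adjoin_one_add_of_mem_adjoin O hY₀mem)
  · rw [hYw, units_conj_nonsing_inv P Y₀ (by rw [hY₀, Matrix.det_mul]; exact (by obtain ⟨d, -, hd⟩ := hp; exact IsUnit.of_mul_eq_one_right d hd : IsUnit _).mul (Matrix.isUnit_nonsing_inv_det _ hNu))]
    change _ ∈ Algebra.adjoin O ({1 + cw⁻¹ • (δw - 1)} : Set (Matrix (Fin 3) (Fin 3) (w.1.adicCompletion L)))
    rw [hXw]
    exact conj_mem_adjoin_of_mem_adjoin O P (mem_adjoin_one_add_of_mem_adjoin O hY₀inv)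
  · change 1 + cw⁻¹ • (δw - 1) ∈ Algebra.adjoin O ({((δ'.val : GL (Fin 3) (LocalRing L v)).val.map evw)} : Set (Matrix (Fin 3) (Fin 3) (w.1.adicCompletion L)))
    rw [hXw, hYw]
    exact conj_mem_adjoin_of_mem_adjoin O P (one_add_mem_adjoin_of_mem O hWmem)

end Literature.NumberTheory.Rogawski1990

end
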